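import Summits.Ventures.CertifiedManyBodySolver.Observables.SourcedGibbsTrialCapAFKSpace
import HarnessLib

/-!
# The AF–BCS sourced cap in momentum space (XVI-b): the SOURCED ENERGY of the antiferromagnetic trial Gibbs state
# (expectation level, equality) — generic decomposition, torus instance

Cell hubbard-obs (seat hubbard-obs-pin-2). HONEST FRAMING: zero compute; the second EXPECTATION-level identity the
thermodynamic-limit packaging of the certified AF–BCS cap needs (`AF-TL-PACKAGING.md`, step 4: the mixing bridge's
`hrows` asks for `Re⟨A_L(U,0,h)⟩_{β,B}/L²` of the trial matrix `B`). §1 is the equality behind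
`groundEnergy_le_HFBCS_spinField_of_conj` (generic lattice, generic spin field); §2 the torus instance for the
spin-field trial family (`w_x = M(−1)^x` is the AF family); the momentum-space closed form then follows from the
identities `af_sum_energy/density/docc/spinField` exactly as in `groundEnergy_dWaveSourceTorus_le_AFBCS_kSpace`
(successor file XVI-c). No number is claimed; not a statement about order; not a superconductivity verdict.

References: Bach–Lieb–Solovej (1994) §2 [BachLiebSolovej1994]; Gaudin (1960) [Gaudin1960]; Lieb (1989) proof of
Theorem 2 [Lieb1989]; Bratteli–Robinson II §5.2.4 [BratteliRobinsonII1997].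
-/

noncomputable section

open Matrix Finset Literature.MathematicalPhysics.QuantumLattice Literature.Probability.LatticeModels
open scoped ComplexConjugate

namespace Summit.Ventures.CertifiedManyBodySolver.Observables

/-! ### §1 The Gibbs expectation of a decomposed Hamiltonian in a spin-field quasi-free state (equality form) -/

section Generic

variable {Λ : Type*} [LinearOrder Λ] [Fintype Λ]

/-- **Generalized-Hartree–Fock energy of a spin-field quasi-free Gibbs state, equality form.** With
`A' = A + a·N + U·Σ_x n_{x↑}n_{x↓} + Σ_x w_x (n_{x↑} − n_{x↓})` and `W A Wᴴ = dΓ(𝓗) − c·1` (`𝓗` Hermitian),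
for every real `β`, with `F = (1 + e^{β𝓗})⁻¹`:
`⟨A'⟩_{β,A} = (Σ_{ij} 𝓗_{ij}F_{ji} − c) + a·Σ_x (F_{x↑,x↑} + 1 − F_{x↓,x↓}) + U·Σ_x (F_{x↑,x↑}(1 − F_{x↓,x↓}) + F_{x↓,x↑}F_{x↑,x↓})
            + Σ_x w_x (F_{x↑,x↑} − 1 + F_{x↓,x↓})` — the identity behind `groundEnergy_le_HFBCS_spinField_of_conj`
(which adds `E₀(A') ≤ Re⟨A'⟩`). [cite: BachLiebSolovej1994, §2] [cite: Gaudin1960] [cite: Lieb1989, proof of Theorem 2] -/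
theorem gibbsState_eq_HFBCS_spinField_of_conj {A A' : Matrix (Finset (Orb Λ)) (Finset (Orb Λ)) ℂ}
    {a U : ℝ} (w : Λ → ℝ)
    (hdec : A' = A + (a : ℂ) • totalNumber + (U : ℂ) • ∑ x : Λ, numberOp x 0 * numberOp x 1 +
      ∑ x : Λ, (w x : ℂ) • (numberOp x 0 - numberOp x 1))
    {𝓗 : Matrix (Orb Λ) (Orb Λ) ℂ} (h𝓗 : 𝓗.IsHermitian) {c : ℂ}
    (hA : partialParticleHole (spinDownOrbitals : Finset (Orb Λ)) * A *
      (partialParticleHole (spinDownOrbitals : Finset (Orb Λ)))ᴴ = dGamma 𝓗 - c • 1) (β : ℝ) :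
    gibbsState β A A' =
      ((∑ i : Orb Λ, ∑ j : Orb Λ, 𝓗 i j * (1 + NormedSpace.exp ((β : ℂ) • 𝓗))⁻¹ j i) - c) +
        (a : ℂ) * (∑ x : Λ,
          ((1 + NormedSpace.exp ((β : ℂ) • 𝓗))⁻¹ (orb x 0) (orb x 0) +
            (1 - (1 + NormedSpace.exp ((β : ℂ) • 𝓗))⁻¹ (orb x 1) (orb x 1)))) +
        (U : ℂ) * (∑ x : Λ,
          ((1 + NormedSpace.exp ((β : ℂ) • 𝓗))⁻¹ (orb x 0) (orb x 0) *
              (1 - (1 + NormedSpace.exp ((β : ℂ) • 𝓗))⁻¹ (orb x 1) (orb x 1)) +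
            (1 + NormedSpace.exp ((β : ℂ) • 𝓗))⁻¹ (orb x 1) (orb x 0) *
              (1 + NormedSpace.exp ((β : ℂ) • 𝓗))⁻¹ (orb x 0) (orb x 1))) +
        (∑ x : Λ, (w x : ℂ) * ((1 + NormedSpace.exp ((β : ℂ) • 𝓗))⁻¹ (orb x 0) (orb x 0) - 1 +
          (1 + NormedSpace.exp ((β : ℂ) • 𝓗))⁻¹ (orb x 1) (orb x 1))) := by
  have hexp : gibbsState β A A' = gibbsState β A A + (a : ℂ) * gibbsState β A totalNumber +
      (U : ℂ) * gibbsState β A (∑ x : Λ, numberOp x 0 * numberOp x 1) +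
      gibbsState β A (∑ x : Λ, (w x : ℂ) • (numberOp x 0 - numberOp x 1)) := by
    rw [hdec, map_add, map_add, map_add, LinearMap.map_smul_of_tower, LinearMap.map_smul_of_tower, smul_eq_mul,
      smul_eq_mul]
  have e3 : gibbsState β A (∑ x : Λ, numberOp x 0 * numberOp x 1) =
      ∑ x : Λ, ((1 + NormedSpace.exp ((β : ℂ) • 𝓗))⁻¹ (orb x 0) (orb x 0) *
            (1 - (1 + NormedSpace.exp ((β : ℂ) • 𝓗))⁻¹ (orb x 1) (orb x 1)) +
          (1 + NormedSpace.exp ((β : ℂ) • 𝓗))⁻¹ (orb x 1) (orb x 0) *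
            (1 + NormedSpace.exp ((β : ℂ) • 𝓗))⁻¹ (orb x 0) (orb x 1)) := by
    rw [map_sum]
    exact Finset.sum_congr rfl fun x _ => gibbsState_docc_of_conj h𝓗 hA β x
  rw [hexp, gibbsState_self_of_conj h𝓗 hA, gibbsState_totalNumber_of_conj h𝓗 hA, e3,
    gibbsState_spinField_of_conj h𝓗 hA β w]

end Generic

/-! ### §2 Torus instance: the AF / spin-field trial Gibbs expectation of the pinned Hubbard torus -/

section Torus

variable (L : ℕ) [NeZero L]

/-- **Gibbs expectation of the pinned torus Hamiltonian in a spin-field quasi-free trial state** (equality form of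
`groundEnergy_dWaveSourceTorus_le_HFBCS_spinField`): with `B = A_L(0,μ',h) + Σ_x w_x (n_{x↑} − n_{x↓})`, its Nambu
matrix `𝓗 = 𝓗_{L,μ',h} + diag(w)` and `F = (1 + e^{β𝓗})⁻¹`,
`⟨A_L(U,μ,h)⟩_{β,B} = (Σ𝓗F − μ'L² − Σw) + (μ'−μ)Σ_x(F_{x↑,x↑} + 1 − F_{x↓,x↓}) + UΣ_x(F_{x↑,x↑}(1 − F_{x↓,x↓}) + F_{x↓,x↑}F_{x↑,x↓})
  + Σ_x(−w_x)(F_{x↑,x↑} − 1 + F_{x↓,x↓})`. [cite: BachLiebSolovej1994, §2] [cite: Lieb1989, proof of Theorem 2] -/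
theorem gibbsState_spinTrial_dWaveSourceTorus_eq (U μ μ' h β : ℝ) (w : FermionTorus 2 L → ℝ) :
    gibbsState β (dWaveSourceTorus L 0 μ' h + ∑ x : FermionTorus 2 L, (w x : ℂ) • (numberOp x 0 - numberOp x 1))
        (dWaveSourceTorus L U μ h) =
      ((∑ i : Orb (FermionTorus 2 L), ∑ j : Orb (FermionTorus 2 L),
          (bdgNambuMatrix
              (fun x y => if (fermionTorusGraph 2 L).Adj x y then -(1 : ℂ) else 0)
              (fun u v : FermionTorus 2 L => -(h : ℂ) * ∑ i : Fin 2,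
                if v = FermionTorus.ofTorusSite (u.toTorusSite + Pi.single i 1) then
                  ((Real.sqrt 2 * (if i = 0 then 1 else -1) : ℝ) : ℂ) else 0) μ' +
            diagonal fun i : Orb (FermionTorus 2 L) => (w (ofLex i).1 : ℂ)) i j *
            (1 + NormedSpace.exp ((β : ℂ) • (bdgNambuMatrix
              (fun x y => if (fermionTorusGraph 2 L).Adj x y then -(1 : ℂ) else 0)
              (fun u v : FermionTorus 2 L => -(h : ℂ) * ∑ i : Fin 2,
                if v = FermionTorus.ofTorusSite (u.toTorusSite + Pi.single i 1) then
                  ((Real.sqrt 2 * (if i = 0 then 1 else -1) : ℝ) : ℂ) else 0) μ' +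
              diagonal fun i : Orb (FermionTorus 2 L) => (w (ofLex i).1 : ℂ))))⁻¹ j i) -
          ((μ' : ℂ) * (L : ℂ) ^ 2 + ∑ x : FermionTorus 2 L, (w x : ℂ))) +
        ((μ' - μ : ℝ) : ℂ) * (∑ x : FermionTorus 2 L,
          ((1 + NormedSpace.exp ((β : ℂ) • (bdgNambuMatrix
              (fun x y => if (fermionTorusGraph 2 L).Adj x y then -(1 : ℂ) else 0)
              (fun u v : FermionTorus 2 L => -(h : ℂ) * ∑ i : Fin 2,
                if v = FermionTorus.ofTorusSite (u.toTorusSite + Pi.single i 1) then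
                  ((Real.sqrt 2 * (if i = 0 then 1 else -1) : ℝ) : ℂ) else 0) μ' +
              diagonal fun i : Orb (FermionTorus 2 L) => (w (ofLex i).1 : ℂ))))⁻¹ (orb x 0) (orb x 0) +
            (1 - (1 + NormedSpace.exp ((β : ℂ) • (bdgNambuMatrix
              (fun x y => if (fermionTorusGraph 2 L).Adj x y then -(1 : ℂ) else 0)
              (fun u v : FermionTorus 2 L => -(h : ℂ) * ∑ i : Fin 2,
                if v = FermionTorus.ofTorusSite (u.toTorusSite + Pi.single i 1) then
                  ((Real.sqrt 2 * (if i = 0 then 1 else -1) : ℝ) : ℂ) else 0) μ' +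
              diagonal fun i : Orb (FermionTorus 2 L) => (w (ofLex i).1 : ℂ))))⁻¹ (orb x 1) (orb x 1)))) +
        (U : ℂ) * (∑ x : FermionTorus 2 L,
          ((1 + NormedSpace.exp ((β : ℂ) • (bdgNambuMatrix
              (fun x y => if (fermionTorusGraph 2 L).Adj x y then -(1 : ℂ) else 0)
              (fun u v : FermionTorus 2 L => -(h : ℂ) * ∑ i : Fin 2,
                if v = FermionTorus.ofTorusSite (u.toTorusSite + Pi.single i 1) then
                  ((Real.sqrt 2 * (if i = 0 then 1 else -1) : ℝ) : ℂ) else 0) μ' +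
              diagonal fun i : Orb (FermionTorus 2 L) => (w (ofLex i).1 : ℂ))))⁻¹ (orb x 0) (orb x 0) *
              (1 - (1 + NormedSpace.exp ((β : ℂ) • (bdgNambuMatrix
              (fun x y => if (fermionTorusGraph 2 L).Adj x y then -(1 : ℂ) else 0)
              (fun u v : FermionTorus 2 L => -(h : ℂ) * ∑ i : Fin 2,
                if v = FermionTorus.ofTorusSite (u.toTorusSite + Pi.single i 1) then
                  ((Real.sqrt 2 * (if i = 0 then 1 else -1) : ℝ) : ℂ) else 0) μ' +
              diagonal fun i : Orb (FermionTorus 2 L) => (w (ofLex i).1 : ℂ))))⁻¹ (orb x 1) (orb x 1)) +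
            (1 + NormedSpace.exp ((β : ℂ) • (bdgNambuMatrix
              (fun x y => if (fermionTorusGraph 2 L).Adj x y then -(1 : ℂ) else 0)
              (fun u v : FermionTorus 2 L => -(h : ℂ) * ∑ i : Fin 2,
                if v = FermionTorus.ofTorusSite (u.toTorusSite + Pi.single i 1) then
                  ((Real.sqrt 2 * (if i = 0 then 1 else -1) : ℝ) : ℂ) else 0) μ' +
              diagonal fun i : Orb (FermionTorus 2 L) => (w (ofLex i).1 : ℂ))))⁻¹ (orb x 1) (orb x 0) *
              (1 + NormedSpace.exp ((β : ℂ) • (bdgNambuMatrix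
              (fun x y => if (fermionTorusGraph 2 L).Adj x y then -(1 : ℂ) else 0)
              (fun u v : FermionTorus 2 L => -(h : ℂ) * ∑ i : Fin 2,
                if v = FermionTorus.ofTorusSite (u.toTorusSite + Pi.single i 1) then
                  ((Real.sqrt 2 * (if i = 0 then 1 else -1) : ℝ) : ℂ) else 0) μ' +
              diagonal fun i : Orb (FermionTorus 2 L) => (w (ofLex i).1 : ℂ))))⁻¹ (orb x 0) (orb x 1))) +
        (∑ x : FermionTorus 2 L, ((-w x : ℝ) : ℂ) *
          ((1 + NormedSpace.exp ((β : ℂ) • (bdgNambuMatrix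
              (fun x y => if (fermionTorusGraph 2 L).Adj x y then -(1 : ℂ) else 0)
              (fun u v : FermionTorus 2 L => -(h : ℂ) * ∑ i : Fin 2,
                if v = FermionTorus.ofTorusSite (u.toTorusSite + Pi.single i 1) then
                  ((Real.sqrt 2 * (if i = 0 then 1 else -1) : ℝ) : ℂ) else 0) μ' +
              diagonal fun i : Orb (FermionTorus 2 L) => (w (ofLex i).1 : ℂ))))⁻¹ (orb x 0) (orb x 0) - 1 +
            (1 + NormedSpace.exp ((β : ℂ) • (bdgNambuMatrix
              (fun x y => if (fermionTorusGraph 2 L).Adj x y then -(1 : ℂ) else 0)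
              (fun u v : FermionTorus 2 L => -(h : ℂ) * ∑ i : Fin 2,
                if v = FermionTorus.ofTorusSite (u.toTorusSite + Pi.single i 1) then
                  ((Real.sqrt 2 * (if i = 0 then 1 else -1) : ℝ) : ℂ) else 0) μ' +
              diagonal fun i : Orb (FermionTorus 2 L) => (w (ofLex i).1 : ℂ))))⁻¹ (orb x 1) (orb x 1))) := by
  have key := gibbsState_eq_HFBCS_spinField_of_conj (Λ := FermionTorus 2 L) (fun x => -w x)
    (dWaveSourceTorus_eq_spinTrial_add L U μ μ' h w) (isHermitian_dWaveNambu_add_spinField L μ' h w)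
    (c := (μ' : ℂ) * (L : ℂ) ^ 2 + ∑ x : FermionTorus 2 L, (w x : ℂ)) (by
      convert spinFieldTorus_conj_nambu L μ' h w using 7) β
  convert key using 40

end Torus

end Summit.Ventures.CertifiedManyBodySolver.Observables
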